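import Summits.CriticalPhenomena.SAWScalingLimit.Theses.SAWCircleScreening
import Summits.CriticalPhenomena.SAWScalingLimit.Theorems.SubseqIdentification.Negative.ProbabilityRedundant
import Literature.Probability.RandomPlanarGeometry.SLEUniquenessInLaw
import Literature.Probability.RandomPlanarGeometry.LocalMartingaleProofs
import HarnessLib

/-!
# Route `SAWCircleScreening`: the support item `EndpointCouplingTame`
(stmt-CriticalPhenomena-5467) — its exact position

`EndpointCouplingTame` is the endpoint-coupling statement (EC) of the route restricted to
Dobrushin domains that are exactly flat (open half-discs) in a ball around each marked point: for
any two endpoint approximations the critical SAW laws, pushed to `CurveClass ℂ`, are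
asymptotically equal in Lévy–Prokhorov distance as `δ → 0⁺`.  It has no proof path of its own:
it is the conclusion of the route's lattice engine `ScreeningRecursion` (stmt-5468, from the
cruxes `ScreenOverlap`, `NoDeepReturn`) and a weakening of the crux `EndpointCoupling`
(stmt-5465).  This file records, kernel-checked against the live route declarations:

* `endpointCouplingTame_of_endpointCoupling` — the one-line closer from the crux (EC);
* `endpointCouplingTame_of_screeningRecursion` — the closer along the route's own mechanism;
* `normal_ne_zero_of_flat`, `flat_inter_ball_of_le` — bookkeeping of the tameness hypothesis
  every consumer needs: the normal `u` of the half-disc is never `0` at a marked (boundary)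
  point, and flatness in the ball of radius `ρ₀` gives flatness in every smaller ball (the form
  in which the cruxes `CircleBridgeAbundance` / `ScreenOverlap` / `NoDeepReturn` take their far
  geometry, scale by scale);
* `tendstoLaw_iff_tendsto_levyProkhorovDist` — on a separable metric Borel space, convergence in
  law along the mesh (`TendstoLaw`, laws only EVENTUALLY probability measures, junk laws padded
  by `exists_probabilityMeasure_eventuallyEq`) is `d_LP(law_δ, limit law) → 0` (Mathlib's
  metrisation theorem `LevyProkhorov.continuous_ofMeasure_probabilityMeasure` and its converse);
* `endpointCoupling_of_sawScalingLimit`, `endpointCouplingTame_of_sawScalingLimit` — NECESSITY: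
  the sub-problem statement `SAWScalingLimit` itself implies (EC), hence the tame item,
  unconditionally (uniqueness of the chordal SLE law is the tree's theorem
  `IsSLECurve.map_eq_holds`; the critical SAW laws are eventually probability measures,
  `SubseqIdentification.Negative.eventually_isProbabilityMeasure_law`).  So the item is not
  stronger than the conjunct it serves, and a refutation of it would refute `SAWScalingLimit`
  as typed;
* `tendstoLaw_of_endpointCoupling_at` — SUFFICIENCY, pointwise: if the laws along `(a, b)` and
  `(a′, b′)` are asymptotically `d_LP`-close and the law along `(a′, b′)` converges to a random
  curve `Γ`, so does the law along `(a, b)` (converging together); the route's assembly item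
  `EndpointCoupling → SomeApproxLimit → SAWScalingLimit` (stmt-5469) is three lines from it
  (file `SAWCircleScreeningAssembly.lean`), so that under `SomeApproxLimit` (EC) is EQUIVALENT to
  the conjunct.

No new definitions.

## References

* P. Billingsley, *Convergence of Probability Measures*, 2nd ed. (1999), §1.2, Thm. 2.1, the
  "converging together" Thm. 3.1, and Thm. 6.8 (Prokhorov metric) [Billingsley1999].
* G. F. Lawler, O. Schramm, W. Werner, *On the scaling limit of planar self-avoiding walk*,
  Proc. Sympos. Pure Math. 72 (2004), §3.4.2 [LawlerSchrammWerner2004SAW].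
-/

noncomputable section

open MeasureTheory Filter Topology Set
open scoped NNReal ENNReal BoundedContinuousFunction
open Literature.Probability.RandomPlanarGeometry Literature.Probability.RandomPlanarGeometry.SAW
open Literature.Probability.LatticeModels

namespace Summit.CriticalPhenomena.SAWScalingLimit.Theorems

open Summit.CriticalPhenomena.SAWScalingLimit.Theses.SAWCircleScreening

/-! ### Closers from other items of the route -/

/-- **The tame item from the crux (EC)**: `EndpointCouplingTame` is `EndpointCoupling` with an
extra (unused) flatness hypothesis, so it closes the moment stmt-CriticalPhenomena-5465 does.
[cite: LawlerSchrammWerner2004SAW, §3.4.2] -/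
theorem endpointCouplingTame_of_endpointCoupling (h : EndpointCoupling) :
    EndpointCouplingTame := by
  unfold EndpointCouplingTame
  intro D a b a' b' _ hab hab'
  exact h D a b a' b' hab hab'

/-- **The tame item along the route's mechanism**: the cruxes `ScreenOverlap` (S2) and
`NoDeepReturn` (S3) and the glue `ScreeningRecursion` (stmt-CriticalPhenomena-5468) give
`EndpointCouplingTame` by modus ponens. [folklore] -/
theorem endpointCouplingTame_of_screeningRecursion (h₂ : ScreenOverlap) (h₃ : NoDeepReturn)
    (hR : ScreeningRecursion) : EndpointCouplingTame :=
  hR h₂ h₃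

/-! ### The tameness hypothesis -/

/-- In the flatness hypothesis `D ∩ B(p, ρ₀) = {z | u = 0 ∨ 0 < Im((z - p) u)} ∩ B(p, ρ₀)` at a
marked point `p = D.pt i` the normal `u` is never `0`: otherwise the whole ball, in particular
the boundary point `p` itself, would lie in the open set `D`. So the tame class consists of
domains that are genuine open HALF-discs near the marked points. [folklore] -/
theorem normal_ne_zero_of_flat {n : ℕ} (D : MarkedDomain n) (i : Fin n) {ρ₀ : ℝ} {u : ℂ}
    (hρ : 0 < ρ₀)
    (h : D.carrier ∩ Metric.ball (D.pt i) ρ₀ =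
      {z | u = 0 ∨ 0 < ((z - D.pt i) * u).im} ∩ Metric.ball (D.pt i) ρ₀) :
    u ≠ 0 := by
  rintro rfl
  have hmem : D.pt i ∈ {z : ℂ | (0 : ℂ) = 0 ∨ 0 < ((z - D.pt i) * 0).im} ∩
      Metric.ball (D.pt i) ρ₀ :=
    ⟨Or.inl rfl, Metric.mem_ball_self hρ⟩
  rw [← h] at hmem
  have hempty : D.carrier ∩ frontier D.carrier = ∅ := D.isOpen.inter_frontier_eq
  have : D.pt i ∈ D.carrier ∩ frontier D.carrier := ⟨hmem.1, D.pt_mem_frontier i⟩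
  rw [hempty] at this
  exact this

/-- Flatness in a ball is inherited by every smaller concentric ball: if
`S ∩ B(c, ρ) = H ∩ B(c, ρ)` and `r ≤ ρ` then `S ∩ B(c, r) = H ∩ B(c, r)` — the form in which the
far-geometry hypothesis of the cruxes (`D.carrier ∩ B(c, 4ρ) = half-plane ∩ B(c, 4ρ)`) is
available at every scale `4ρ ≤ ρ₀`. [folklore] -/
theorem flat_inter_ball_of_le {S H : Set ℂ} {c : ℂ} {ρ r : ℝ}
    (h : S ∩ Metric.ball c ρ = H ∩ Metric.ball c ρ) (hr : r ≤ ρ) :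
    S ∩ Metric.ball c r = H ∩ Metric.ball c r := by
  have hsub : Metric.ball c ρ ∩ Metric.ball c r = Metric.ball c r :=
    inter_eq_right.2 (Metric.ball_subset_ball hr)
  calc S ∩ Metric.ball c r = S ∩ Metric.ball c ρ ∩ Metric.ball c r := by
        rw [inter_assoc, hsub]
    _ = H ∩ Metric.ball c ρ ∩ Metric.ball c r := by rw [h]
    _ = H ∩ Metric.ball c r := by rw [inter_assoc, hsub]

/-! ### Lévy–Prokhorov metrisation along the mesh -/

/-- On a separable pseudo-metric space, weak convergence of probability measures `μ i ⇒ ν`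
forces `d_LP(μ i, ν) → 0` (the Lévy–Prokhorov metric metrises convergence in distribution;
Mathlib's `LevyProkhorov.continuous_ofMeasure_probabilityMeasure`). Billingsley (1999),
Thm. 6.8. [cite: Billingsley1999, Thm. 6.8] -/
theorem tendsto_levyProkhorovDist_of_tendsto {X : Type*} [PseudoMetricSpace X]
    [MeasurableSpace X] [OpensMeasurableSpace X] [TopologicalSpace.SeparableSpace X]
    {ι : Type*} {l : Filter ι} {μ : ι → ProbabilityMeasure X} {ν : ProbabilityMeasure X}
    (h : Tendsto μ l (𝓝 ν)) :
    Tendsto (fun i ↦ levyProkhorovDist (μ i : Measure X) (ν : Measure X)) l (𝓝 0) := by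
  have h' := (LevyProkhorov.continuous_ofMeasure_probabilityMeasure.tendsto ν).comp h
  rw [tendsto_iff_dist_tendsto_zero] at h'
  simpa [LevyProkhorov.dist_probabilityMeasure_def] using h'

/-- Conversely (no separability needed), `d_LP(μ i, ν) → 0` forces weak convergence `μ i ⇒ ν`
(Mathlib's `LevyProkhorov.continuous_toMeasure_probabilityMeasure`). Billingsley (1999),
Thm. 6.8. [cite: Billingsley1999, Thm. 6.8] -/
theorem tendsto_of_tendsto_levyProkhorovDist {X : Type*} [PseudoMetricSpace X]
    [MeasurableSpace X] [OpensMeasurableSpace X]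
    {ι : Type*} {l : Filter ι} {μ : ι → ProbabilityMeasure X} {ν : ProbabilityMeasure X}
    (h : Tendsto (fun i ↦ levyProkhorovDist (μ i : Measure X) (ν : Measure X)) l (𝓝 0)) :
    Tendsto μ l (𝓝 ν) := by
  have h' : Tendsto (fun i ↦ LevyProkhorov.ofMeasure (μ i)) l
      (𝓝 (LevyProkhorov.ofMeasure ν)) := by
    rw [tendsto_iff_dist_tendsto_zero]
    simpa [LevyProkhorov.dist_probabilityMeasure_def] using h
  exact (LevyProkhorov.continuous_toMeasure_probabilityMeasure.tendsto _).comp h'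

/-- Padding a family of laws that are probability measures only eventually: there is a family
of probability measures agreeing with it eventually (elsewhere it is the given fallback `ν`).
The device by which statements along `𝓝[>] 0` about junk-valued lattice laws are fed to
Mathlib's `ProbabilityMeasure` API. [folklore] -/
theorem exists_probabilityMeasure_eventuallyEq {X : Type*} [MeasurableSpace X] {l : Filter ℝ}
    {m : ℝ → Measure X} (hm : ∀ᶠ δ in l, IsProbabilityMeasure (m δ))
    (ν : ProbabilityMeasure X) :
    ∃ μ : ℝ → ProbabilityMeasure X, ∀ᶠ δ in l, ((μ δ : ProbabilityMeasure X) : Measure X) = m δ := by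
  classical
  refine ⟨fun δ ↦ if hδ : IsProbabilityMeasure (m δ) then ⟨m δ, hδ⟩ else ν, ?_⟩
  filter_upwards [hm] with δ hδ
  simp only [dif_pos hδ, ProbabilityMeasure.coe_mk]

/-- **`TendstoLaw` along the mesh is `d_LP → 0`.** If the laws `P δ` are probability measures
for all small `δ > 0`, the observables `Y δ` are a.e.-measurable with values in a separable
metric Borel space, and `Z` is a.e.-measurable under the probability measure `P'`, then
`Y δ → Z` in law along `𝓝[>] 0` (`TendstoLaw`, bounded continuous test functions) iff the
Lévy–Prokhorov distance between the law of `Y δ` and the law of `Z` tends to `0`. (The junk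
laws at large `δ` are padded by the limit law, `exists_probabilityMeasure_eventuallyEq`, before
invoking the metrisation theorem; both sides only see small `δ`.) Billingsley (1999), §1.2 and
Thm. 6.8. [cite: Billingsley1999, Thm. 6.8] -/
theorem tendstoLaw_iff_tendsto_levyProkhorovDist {Ωδ : ℝ → Type*}
    [∀ δ, MeasurableSpace (Ωδ δ)] {Ω' : Type*} [MeasurableSpace Ω'] {X : Type*}
    [PseudoMetricSpace X] [MeasurableSpace X] [BorelSpace X]
    [TopologicalSpace.SeparableSpace X]
    {Y : ∀ δ, Ωδ δ → X} {P : ∀ δ, Measure (Ωδ δ)} {Z : Ω' → X} {P' : Measure Ω'}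
    [IsProbabilityMeasure P'] (hP : ∀ᶠ δ in 𝓝[>] (0 : ℝ), IsProbabilityMeasure (P δ))
    (hY : ∀ δ, AEMeasurable (Y δ) (P δ)) (hZ : AEMeasurable Z P') :
    TendstoLaw Y P Z P' ↔
      Tendsto (fun δ ↦ levyProkhorovDist ((P δ).map (Y δ)) (P'.map Z)) (𝓝[>] (0 : ℝ))
        (𝓝 0) := by
  -- the limit law and the padded family, as probability measures on `X`
  let ν : ProbabilityMeasure X := ⟨P'.map Z, Measure.isProbabilityMeasure_map hZ⟩
  have hP' : ∀ᶠ δ in 𝓝[>] (0 : ℝ), IsProbabilityMeasure ((P δ).map (Y δ)) := by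
    filter_upwards [hP] with δ hδ
    haveI := hδ
    exact Measure.isProbabilityMeasure_map (hY δ)
  obtain ⟨μ, hμ⟩ := exists_probabilityMeasure_eventuallyEq hP' ν
  -- `TendstoLaw` is weak convergence of the padded family …
  have hweak : TendstoLaw Y P Z P' ↔ Tendsto μ (𝓝[>] (0 : ℝ)) (𝓝 ν) := by
    rw [ProbabilityMeasure.tendsto_iff_forall_integral_tendsto]
    refine forall_congr' fun f ↦ ?_
    rw [show (∫ x, f x ∂(ν : Measure X)) = ∫ ω, f (Z ω) ∂P' from
      integral_map hZ f.continuous.aestronglyMeasurable]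
    refine tendsto_congr' ?_
    filter_upwards [hμ] with δ hδ
    rw [hδ, integral_map (hY δ) f.continuous.aestronglyMeasurable]
  -- … and `d_LP → 0` is `d_LP → 0` for the padded family
  have hdist : Tendsto (fun δ ↦ levyProkhorovDist ((P δ).map (Y δ)) (P'.map Z))
      (𝓝[>] (0 : ℝ)) (𝓝 0) ↔ Tendsto (fun δ ↦ levyProkhorovDist (μ δ : Measure X)
        (ν : Measure X)) (𝓝[>] (0 : ℝ)) (𝓝 0) := by
    refine tendsto_congr' ?_
    filter_upwards [hμ] with δ hδ
    rw [hδ]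
    rfl
  rw [hweak, hdist]
  exact ⟨tendsto_levyProkhorovDist_of_tendsto, tendsto_of_tendsto_levyProkhorovDist⟩

/-! ### Necessity: the conjunct implies (EC), hence the tame item -/

open Literature.Probability in
/-- **`SAWScalingLimit` implies the crux `EndpointCoupling`** (stmt-CriticalPhenomena-5465),
unconditionally. Along two endpoint approximations of the same Dobrushin domain the conjunct
gives convergence in law to chordal SLE_{8/3} random curves `Γ`, `Γ'`; their laws coincide
(`IsSLECurve.map_eq_holds`); the critical SAW laws are eventually probability measures
(`eventually_isProbabilityMeasure_law`), so both Lévy–Prokhorov distances to the common SLE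
law tend to `0` (`tendstoLaw_iff_tendsto_levyProkhorovDist`), and the triangle inequality for
`d_LP` between finite measures concludes ("converging together", Billingsley (1999), Thm. 3.1).
[cite: Billingsley1999, Thm. 3.1] -/
theorem endpointCoupling_of_sawScalingLimit (h : _root_.SAWScalingLimit) : EndpointCoupling := by
  intro D a b a' b' hab hab'
  haveI : IsProbabilityMeasure Process.preWienerMeasure := isProbabilityMeasure_preWienerMeasure'
  obtain ⟨Γ, hΓ, -, hT⟩ := h D a b hab
  obtain ⟨Γ', hΓ', -, hT'⟩ := h D a' b' hab'
  set W := Process.preWienerMeasure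
  have hlaw : W.map Γ' = W.map Γ := IsSLECurve.map_eq_holds hΓ' hΓ
  haveI : IsProbabilityMeasure (W.map Γ) := Measure.isProbabilityMeasure_map hΓ.aemeasurable
  have hPa := SubseqIdentification.Negative.eventually_isProbabilityMeasure_law hab
  have hPa' := SubseqIdentification.Negative.eventually_isProbabilityMeasure_law hab'
  have h1 := (tendstoLaw_iff_tendsto_levyProkhorovDist hPa (fun δ ↦ aemeasurable_curve _ _ _ _)
    hΓ.aemeasurable).1 hT
  have h2 := (tendstoLaw_iff_tendsto_levyProkhorovDist hPa' (fun δ ↦ aemeasurable_curve _ _ _ _)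
    hΓ'.aemeasurable).1 hT'
  rw [hlaw] at h2
  have hsum := h1.add h2
  rw [add_zero] at hsum
  refine squeeze_zero' (Eventually.of_forall fun δ ↦ ENNReal.toReal_nonneg) ?_ hsum
  filter_upwards [hPa, hPa'] with δ hδ hδ'
  haveI := hδ
  haveI := hδ'
  haveI : IsProbabilityMeasure ((law D.carrier δ (a δ) (b δ)).map fun γ ↦ γ.curve) :=
    Measure.isProbabilityMeasure_map (aemeasurable_curve _ _ _ _)
  haveI : IsProbabilityMeasure ((law D.carrier δ (a' δ) (b' δ)).map fun γ ↦ γ.curve) :=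
    Measure.isProbabilityMeasure_map (aemeasurable_curve _ _ _ _)
  calc levyProkhorovDist ((law D.carrier δ (a δ) (b δ)).map fun γ ↦ γ.curve)
        ((law D.carrier δ (a' δ) (b' δ)).map fun γ ↦ γ.curve)
      ≤ levyProkhorovDist ((law D.carrier δ (a δ) (b δ)).map fun γ ↦ γ.curve) (W.map Γ) +
        levyProkhorovDist (W.map Γ) ((law D.carrier δ (a' δ) (b' δ)).map fun γ ↦ γ.curve) :=
        levyProkhorovDist_triangle _ _ _
    _ = _ := by rw [levyProkhorovDist_comm (W.map Γ)]

/-- **`SAWScalingLimit` implies the support item `EndpointCouplingTame`**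
(stmt-CriticalPhenomena-5467), unconditionally: the item is a consequence of the sub-problem
statement it serves (via `endpointCoupling_of_sawScalingLimit`), so it is not misstated in the
strong sense — refuting it would refute the conjunct as typed. [cite: Billingsley1999, Thm. 3.1]
-/
theorem endpointCouplingTame_of_sawScalingLimit (h : _root_.SAWScalingLimit) :
    EndpointCouplingTame :=
  endpointCouplingTame_of_endpointCoupling (endpointCoupling_of_sawScalingLimit h)

/-! ### Sufficiency: converging together along the mesh -/

open Literature.Probability in
/-- **Converging together for the critical SAW laws.** If along two endpoint approximations
`(a, b)`, `(a′, b′)` of the same Dobrushin domain the pushed-forward critical SAW laws are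
asymptotically `d_LP`-close (the instance of (EC) at `(D; a, b; a′, b′)`), and along `(a′, b′)`
the law converges (`TendstoLaw`) to a random curve `Γ` on the pre-Wiener space, then so does the
law along `(a, b)`, to the SAME `Γ`: `d_LP(law_δ(a,b), law Γ) ≤ d_LP(law_δ(a,b), law_δ(a′,b′)) +
d_LP(law_δ(a′,b′), law Γ) → 0` (all three laws are eventually probability measures) and
`tendstoLaw_iff_tendsto_levyProkhorovDist`. With `SomeApproxLimit` supplying `(a′, b′)` and an
SLE_{8/3} curve `Γ` this is the route's assembly item (stmt-CriticalPhenomena-5469, file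
`SAWCircleScreeningAssembly.lean`). Billingsley (1999), Thm. 3.1. [cite: Billingsley1999, Thm. 3.1]
-/
theorem tendstoLaw_of_endpointCoupling_at {D : DobrushinDomain} {a b a' b' : ℝ → Site 2}
    (hab : IsEndpointApprox D a b) (hab' : IsEndpointApprox D a' b')
    {Γ : (ℝ≥0 → ℝ) → CurveClass ℂ} (hΓ : AEMeasurable Γ Process.preWienerMeasure)
    (hEC : Tendsto (fun δ ↦ levyProkhorovDist
      ((law D.carrier δ (a δ) (b δ)).map fun γ ↦ γ.curve)
      ((law D.carrier δ (a' δ) (b' δ)).map fun γ ↦ γ.curve)) (𝓝[>] (0 : ℝ)) (𝓝 0))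
    (hT' : TendstoLaw (fun δ (γ : DomainSAW D.carrier δ (a' δ) (b' δ)) ↦ γ.curve)
      (fun δ ↦ law D.carrier δ (a' δ) (b' δ)) Γ Process.preWienerMeasure) :
    TendstoLaw (fun δ (γ : DomainSAW D.carrier δ (a δ) (b δ)) ↦ γ.curve)
      (fun δ ↦ law D.carrier δ (a δ) (b δ)) Γ Process.preWienerMeasure := by
  haveI : IsProbabilityMeasure Process.preWienerMeasure := isProbabilityMeasure_preWienerMeasure'
  haveI : IsProbabilityMeasure (Process.preWienerMeasure.map Γ) :=
    Measure.isProbabilityMeasure_map hΓ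
  have hPa := SubseqIdentification.Negative.eventually_isProbabilityMeasure_law hab
  have hPa' := SubseqIdentification.Negative.eventually_isProbabilityMeasure_law hab'
  refine (tendstoLaw_iff_tendsto_levyProkhorovDist hPa (fun δ ↦ aemeasurable_curve _ _ _ _)
    hΓ).2 ?_
  have h2 := (tendstoLaw_iff_tendsto_levyProkhorovDist hPa' (fun δ ↦ aemeasurable_curve _ _ _ _)
    hΓ).1 hT'
  have hsum := hEC.add h2
  rw [add_zero] at hsum
  refine squeeze_zero' (Eventually.of_forall fun δ ↦ ENNReal.toReal_nonneg) ?_ hsum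
  filter_upwards [hPa, hPa'] with δ hδ hδ'
  haveI := hδ
  haveI := hδ'
  haveI : IsProbabilityMeasure ((law D.carrier δ (a δ) (b δ)).map fun γ ↦ γ.curve) :=
    Measure.isProbabilityMeasure_map (aemeasurable_curve _ _ _ _)
  haveI : IsProbabilityMeasure ((law D.carrier δ (a' δ) (b' δ)).map fun γ ↦ γ.curve) :=
    Measure.isProbabilityMeasure_map (aemeasurable_curve _ _ _ _)
  exact levyProkhorovDist_triangle _ _ _

end Summit.CriticalPhenomena.SAWScalingLimit.Theorems
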